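import Mathlib
import Literature.NumberTheory.Transcendental.SemialgebraicMapsProofs
import Literature.NumberTheory.Transcendental.SemialgebraicVolume
import Literature.ModelTheory.ExponentialFields.SemialgebraicInterior
import Literature.NumberTheory.Transcendental.SemialgebraicGrounding
import Summits.KontsevichZagierPeriods.KontsevichZagierPeriods.Theorems.SymplecticScissorsPlanarSAZylevStubMosaic

/-!
# Crux `SymplecticScissors.PlanarSAZylev` (stmt-KontsevichZagierPeriods-9848), line `reservoir-peeling`:
elementary instances of the pinned pseudogroup equivalence, and bounded models

The pinned relation `E A B` of the line ("an open co-null `ℚ`-semialgebraic part `U` of `A` is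
carried by ONE `ℚ`-semialgebraic `C¹` injection with `|det| = 1` onto a co-null part of `B`") is
quantified together with its defining hypothesis `HE`, as in every stub of the line.  This file
supplies the elementary instances consumed by the assembly:

* `assembly_refl`, `assembly_null`, `assembly_subConull` — reflexivity on `ℚ`-semialgebraic sets,
  null pairs, co-null `ℚ`-semialgebraic subsets (both directions), all by the identity map;
* `assembly_swap` — the coordinate swap carries `S` onto `Grounding.perm (swap 0 1) S`;
* `assembly_exists_shift` — two bounded planar sets are separated by a rational translation;
* `assembly_compress` — **bounded models**: granted transitivity of `E`, the symplectic grounding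
  of the last coordinate (stub `stub_groundLast`) and the compression of down-sets (stub
  `stub_downset`), every finite-area `ℚ`-region is `E`-equivalent to a BOUNDED one: ground both
  coordinates (`Grounding.groundIter S 2`, conjugating by the swap) and compress the resulting
  down-set of the open quadrant.

No definitions; [folklore] bookkeeping over the tree's `SemialgebraicGrounding.lean`.
-/

noncomputable section

open MeasureTheory Set
open Literature.NumberTheory.Transcendental Literature.ModelTheory.ExponentialFields

namespace Summit.KontsevichZagierPeriods.SymplecticScissors.PlanarSAZylev

/-- **Reflexivity** of the pinned relation on `ℚ`-semialgebraic sets (translation by `0`).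
[folklore] -/
theorem assembly_refl (E : Set (Fin 2 → ℝ) → Set (Fin 2 → ℝ) → Prop)
    (HE : ∀ A B : Set (Fin 2 → ℝ), E A B ↔
        ∃ (U : Set (Fin 2 → ℝ)) (Φ : (Fin 2 → ℝ) → (Fin 2 → ℝ)),
          U ⊆ A ∧ IsSemialgebraic ℚ U ∧ IsOpen U ∧ volume (A \ U) = 0 ∧
          IsSemialgebraicMapOn ℚ U Φ ∧ ContDiffOn ℝ 1 Φ U ∧ InjOn Φ U ∧
          (∀ p ∈ U, |(fderiv ℝ Φ p).det| = 1) ∧ Φ '' U ⊆ B ∧ volume (B \ Φ '' U) = 0)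
    {P : Set (Fin 2 → ℝ)} (hP : IsSemialgebraic ℚ P) : E P P := by
  simpa using mosaic_translate E HE hP 0 0 fun i => by simp

/-- **Null pairs**: two Lebesgue-null sets are related (empty witness). [folklore] -/
theorem assembly_null (E : Set (Fin 2 → ℝ) → Set (Fin 2 → ℝ) → Prop)
    (HE : ∀ A B : Set (Fin 2 → ℝ), E A B ↔
        ∃ (U : Set (Fin 2 → ℝ)) (Φ : (Fin 2 → ℝ) → (Fin 2 → ℝ)),
          U ⊆ A ∧ IsSemialgebraic ℚ U ∧ IsOpen U ∧ volume (A \ U) = 0 ∧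
          IsSemialgebraicMapOn ℚ U Φ ∧ ContDiffOn ℝ 1 Φ U ∧ InjOn Φ U ∧
          (∀ p ∈ U, |(fderiv ℝ Φ p).det| = 1) ∧ Φ '' U ⊆ B ∧ volume (B \ Φ '' U) = 0)
    {A B : Set (Fin 2 → ℝ)} (hA : volume A = 0) (hB : volume B = 0) : E A B := by
  refine (HE A B).2 ⟨∅, id, empty_subset _, isSemialgebraic_empty, isOpen_empty, by simpa using hA,
    ?_, contDiffOn_id, injOn_empty _, fun p hp => hp.elim, by simp, by simpa using hB⟩
  unfold IsSemialgebraicMapOn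
  convert (isSemialgebraic_empty : IsSemialgebraic ℚ (∅ : Set (Fin (2 + 2) → ℝ))) using 1
  ext z
  simp

/-- The Jacobian determinant of the identity of the plane is `1`. [folklore] -/
theorem assembly_det_id (p : Fin 2 → ℝ) : |(fderiv ℝ (fun x : Fin 2 → ℝ => x) p).det| = 1 := by
  simpa using mosaic_det_translate 0 p

/-- **Co-null `ℚ`-semialgebraic subsets are related, in both directions**: the identity on the
interior of the smaller set is a witness (`A' \ interior A'` lies in the null frontier of `A'`).
[folklore] -/
theorem assembly_subConull (E : Set (Fin 2 → ℝ) → Set (Fin 2 → ℝ) → Prop)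
    (HE : ∀ A B : Set (Fin 2 → ℝ), E A B ↔
        ∃ (U : Set (Fin 2 → ℝ)) (Φ : (Fin 2 → ℝ) → (Fin 2 → ℝ)),
          U ⊆ A ∧ IsSemialgebraic ℚ U ∧ IsOpen U ∧ volume (A \ U) = 0 ∧
          IsSemialgebraicMapOn ℚ U Φ ∧ ContDiffOn ℝ 1 Φ U ∧ InjOn Φ U ∧
          (∀ p ∈ U, |(fderiv ℝ Φ p).det| = 1) ∧ Φ '' U ⊆ B ∧ volume (B \ Φ '' U) = 0)
    {A A' : Set (Fin 2 → ℝ)} (hsub : A' ⊆ A) (hA' : IsSemialgebraic ℚ A')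
    (hnull : volume (A \ A') = 0) : E A A' ∧ E A' A := by
  have hfr : volume (A' \ interior A') = 0 := by
    refine measure_mono_null (fun x hx => ?_) (volume_frontier_eq_zero_of_isSemialgebraic hA')
    exact ⟨subset_closure hx.1, hx.2⟩
  have hbig : volume (A \ interior A') = 0 := by
    refine measure_mono_null (fun x hx => ?_) (measure_union_null hnull hfr)
    by_cases h : x ∈ A'
    · exact Or.inr ⟨h, hx.2⟩
    · exact Or.inl ⟨hx.1, h⟩
  have hsa : IsSemialgebraicMapOn ℚ (interior A') (fun x : Fin 2 → ℝ => x) :=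
    (isSemialgebraicMapOn_id (isSemialgebraic_interior hA')).congr fun _ _ => rfl
  refine ⟨(HE A A').2 ⟨interior A', fun x => x, interior_subset.trans hsub,
      isSemialgebraic_interior hA', isOpen_interior, hbig, hsa, contDiffOn_id, injOn_id _,
      fun p _ => assembly_det_id p, by simpa using interior_subset, by simpa using hfr⟩,
    (HE A' A).2 ⟨interior A', fun x => x, interior_subset, isSemialgebraic_interior hA',
      isOpen_interior, hfr, hsa, contDiffOn_id, injOn_id _, fun p _ => assembly_det_id p,
      by simpa using interior_subset.trans hsub, by simpa using hbig⟩⟩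

/-! ### The coordinate swap -/

/-- The coordinate swap of the plane as a continuous linear map. [folklore] -/
theorem assembly_swap_hasFDerivAt (σ : Equiv.Perm (Fin 2)) (p : Fin 2 → ℝ) :
    HasFDerivAt (fun x : Fin 2 → ℝ => x ∘ σ)
      (ContinuousLinearMap.pi fun i => ContinuousLinearMap.proj (R := ℝ) (φ := fun _ : Fin 2 => ℝ)
        (σ i)) p := by
  have : (fun x : Fin 2 → ℝ => x ∘ σ) = fun x => (ContinuousLinearMap.pi fun i =>
      ContinuousLinearMap.proj (R := ℝ) (φ := fun _ : Fin 2 => ℝ) (σ i)) x := by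
    funext x; ext i; simp
  rw [this]
  exact ContinuousLinearMap.hasFDerivAt _

/-- The coordinate permutation map has Jacobian of absolute value `1`: it preserves Lebesgue
measure (`Grounding.measurePreserving_comp_perm`), and a linear map scales Lebesgue measure by
`|det|` (`addHaar_image_continuousLinearMap`). [folklore] -/
theorem assembly_swap_det (σ : Equiv.Perm (Fin 2)) (p : Fin 2 → ℝ) :
    |(fderiv ℝ (fun x : Fin 2 → ℝ => x ∘ σ) p).det| = 1 := by
  set L : (Fin 2 → ℝ) →L[ℝ] (Fin 2 → ℝ) := ContinuousLinearMap.pi fun i =>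
    ContinuousLinearMap.proj (R := ℝ) (φ := fun _ : Fin 2 => ℝ) (σ i) with hL
  rw [(assembly_swap_hasFDerivAt σ p).fderiv]
  have hLfun : (L : (Fin 2 → ℝ) → (Fin 2 → ℝ)) = fun x => x ∘ σ := by
    funext x; ext i; simp [hL]
  -- the unit cube has measure one and is carried to a set of measure `|det L|`
  have hcube : volume (Set.pi univ fun _ : Fin 2 => Ico (0 : ℝ) 1) = 1 := by
    rw [volume_pi_pi]; simp
  have himg := Measure.addHaar_image_continuousLinearMap (volume : Measure (Fin 2 → ℝ)) L
    (Set.pi univ fun _ : Fin 2 => Ico (0 : ℝ) 1)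
  have hpres : volume (L '' Set.pi univ fun _ : Fin 2 => Ico (0 : ℝ) 1) = 1 := by
    have hmp := Grounding.measurePreserving_comp_perm (m := 1) σ
    have hbij : Function.Bijective fun x : Fin 2 → ℝ => x ∘ σ :=
      ⟨fun x y h => by
        funext i
        have := congrFun h (σ.symm i)
        simpa using this,
       fun y => ⟨y ∘ σ.symm, by funext i; simp⟩⟩
    rw [hLfun, ← hcube]
    rw [image_eq_preimage_of_inverse (g := fun x : Fin 2 → ℝ => x ∘ σ.symm)
      (fun x => by funext i; simp) (fun x => by funext i; simp)]
    have hmp' := Grounding.measurePreserving_comp_perm (m := 1) σ.symm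
    exact hmp'.measure_preimage (MeasurableSet.univ_pi fun _ => measurableSet_Ico).nullMeasurableSet
  rw [hpres, hcube, mul_one] at himg
  have h1 : ENNReal.ofReal |LinearMap.det (L : (Fin 2 → ℝ) →ₗ[ℝ] (Fin 2 → ℝ))| = 1 := himg.symm
  have : |LinearMap.det (L : (Fin 2 → ℝ) →ₗ[ℝ] (Fin 2 → ℝ))| = 1 := by
    have h2 := congrArg ENNReal.toReal h1
    rwa [ENNReal.toReal_ofReal (abs_nonneg _), ENNReal.toReal_one] at h2
  exact this

/-- **The coordinate swap is an instance of `E`**: for a `ℚ`-semialgebraic `S`,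
`E S (Grounding.perm σ S)` for every permutation `σ` of the two coordinates with `σ = σ⁻¹`
(witness: `x ↦ x ∘ σ` on the interior of `S`). [folklore] -/
theorem assembly_swap (E : Set (Fin 2 → ℝ) → Set (Fin 2 → ℝ) → Prop)
    (HE : ∀ A B : Set (Fin 2 → ℝ), E A B ↔
        ∃ (U : Set (Fin 2 → ℝ)) (Φ : (Fin 2 → ℝ) → (Fin 2 → ℝ)),
          U ⊆ A ∧ IsSemialgebraic ℚ U ∧ IsOpen U ∧ volume (A \ U) = 0 ∧
          IsSemialgebraicMapOn ℚ U Φ ∧ ContDiffOn ℝ 1 Φ U ∧ InjOn Φ U ∧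
          (∀ p ∈ U, |(fderiv ℝ Φ p).det| = 1) ∧ Φ '' U ⊆ B ∧ volume (B \ Φ '' U) = 0)
    (σ : Equiv.Perm (Fin 2)) (hσ : ∀ i, σ (σ i) = i) {S : Set (Fin 2 → ℝ)}
    (hS : IsSemialgebraic ℚ S) : E S (Grounding.perm (m := 1) σ S) := by
  have hfr : volume (S \ interior S) = 0 := by
    refine measure_mono_null (fun x hx => ?_) (volume_frontier_eq_zero_of_isSemialgebraic hS)
    exact ⟨subset_closure hx.1, hx.2⟩
  have hinv : ∀ x : Fin 2 → ℝ, (x ∘ σ) ∘ σ = x := fun x => by funext i; simp [hσ i]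
  have hinj : Function.Injective fun x : Fin 2 → ℝ => x ∘ σ := fun x y h => by
    have := congrArg (fun z : Fin 2 → ℝ => z ∘ σ) h
    simpa only [hinv] using this
  have hsa : IsSemialgebraicMapOn ℚ (interior S) fun x : Fin 2 → ℝ => x ∘ σ := by
    refine (isSemialgebraicMapOn_aeval (isSemialgebraic_interior hS)
      (fun j => (MvPolynomial.X (σ j) : MvPolynomial (Fin 2) ℚ))).congr fun x _ => ?_
    funext j
    simp
  have hcd : ContDiffOn ℝ 1 (fun x : Fin 2 → ℝ => x ∘ σ) (interior S) := by
    have : ContDiff ℝ 1 fun x : Fin 2 → ℝ => x ∘ σ :=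
      contDiff_pi.2 fun i => contDiff_apply ℝ ℝ (σ i)
    exact this.contDiffOn
  have himgS : (fun x : Fin 2 → ℝ => x ∘ σ) '' S = Grounding.perm (m := 1) σ S := by
    ext y
    simp only [mem_image, Grounding.mem_perm]
    constructor
    · rintro ⟨x, hx, rfl⟩
      rw [hinv]; exact hx
    · intro hy
      exact ⟨y ∘ σ, hy, hinv y⟩
  refine (HE _ _).2 ⟨interior S, fun x => x ∘ σ, interior_subset, isSemialgebraic_interior hS,
    isOpen_interior, hfr, hsa, hcd, hinj.injOn, fun p _ => assembly_swap_det σ p, ?_, ?_⟩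
  · rw [← himgS]
    exact image_mono interior_subset
  · rw [← himgS, ← image_sdiff hinj]
    have hmp := Grounding.measurePreserving_comp_perm (m := 1) σ
    rw [image_eq_preimage_of_inverse (g := fun x : Fin 2 → ℝ => x ∘ σ) hinv hinv]
    exact hmp.preimage_null hfr

/-! ### Separation of bounded sets by a rational translation -/

/-- Two bounded planar sets are made disjoint by a rational (indeed integer) translation of the
second. [folklore] -/
theorem assembly_exists_shift {A B : Set (Fin 2 → ℝ)} (hA : Bornology.IsBounded A)
    (hB : Bornology.IsBounded B) :
    ∃ q : Fin 2 → ℚ, Disjoint A ((fun x => x + fun i => (q i : ℝ)) '' B) := by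
  obtain ⟨NA, hNA⟩ := mosaic_exists_bound hA
  obtain ⟨NB, hNB⟩ := mosaic_exists_bound hB
  refine ⟨![(NA : ℚ) + NB + 1, 0], Set.disjoint_left.2 ?_⟩
  rintro x hx ⟨y, hy, rfl⟩
  have h1 := (abs_le.1 (hNA _ hx 0)).2
  have h2 := (abs_le.1 (hNB y hy 0)).1
  have h3 : (y + fun i => (((![(NA : ℚ) + NB + 1, 0] : Fin 2 → ℚ) i : ℚ) : ℝ)) 0 =
      y 0 + ((NA : ℝ) + NB + 1) := by
    simp
  dsimp only at h1
  rw [h3] at h1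
  linarith

/-! ### Bounded models -/

/-- `Grounding.groundAt` in the last coordinate is `Grounding.groundLast` (the conjugating
transposition is the identity). [folklore] -/
theorem assembly_groundAt_last {m : ℕ} (S : Set (Fin (m + 1) → ℝ)) :
    Grounding.groundAt (Fin.last m) S = Grounding.groundLast S := by
  have hperm : ∀ T : Set (Fin (m + 1) → ℝ), Grounding.perm (Equiv.swap (Fin.last m) (Fin.last m)) T
      = T := fun T => by
    ext x
    rw [Grounding.mem_perm, Equiv.swap_self]
    simp
  rw [Grounding.groundAt, hperm, hperm]

/-- **Bounded models.** Granted transitivity of `E`, the symplectic grounding of the last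
coordinate and the compression of finite-area down-sets of the open quadrant, every `ℚ`-region
of finite area is `E`-equivalent to a bounded `ℚ`-region: `S ~ perm S ~ groundLast (perm S) ~
perm (groundLast (perm S)) = groundIter S 1 ~ groundLast (groundIter S 1) = groundIter S 2`, a
finite-area down-set of the open quadrant (`Grounding.groundIter_spec`), `~` a bounded set.
[folklore] -/
theorem assembly_compress (E : Set (Fin 2 → ℝ) → Set (Fin 2 → ℝ) → Prop)
    (HE : ∀ A B : Set (Fin 2 → ℝ), E A B ↔
        ∃ (U : Set (Fin 2 → ℝ)) (Φ : (Fin 2 → ℝ) → (Fin 2 → ℝ)),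
          U ⊆ A ∧ IsSemialgebraic ℚ U ∧ IsOpen U ∧ volume (A \ U) = 0 ∧
          IsSemialgebraicMapOn ℚ U Φ ∧ ContDiffOn ℝ 1 Φ U ∧ InjOn Φ U ∧
          (∀ p ∈ U, |(fderiv ℝ Φ p).det| = 1) ∧ Φ '' U ⊆ B ∧ volume (B \ Φ '' U) = 0)
    (htrans : ∀ A B C : Set (Fin 2 → ℝ), E A B → E B C → E A C)
    (hground : ∀ S : Set (Fin 2 → ℝ), IsSemialgebraic ℚ S → volume S ≠ ⊤ →
      E S (Grounding.groundLast S))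
    (hdownset : ∀ D : Set (Fin 2 → ℝ), IsSemialgebraic ℚ D → volume D ≠ ⊤ →
      (∀ x ∈ D, ∀ i, 0 < x i) →
      (∀ x ∈ D, ∀ y : Fin 2 → ℝ, (∀ i, 0 < y i ∧ y i ≤ x i) → y ∈ D) →
      ∃ B : Set (Fin 2 → ℝ), IsSemialgebraic ℚ B ∧ Bornology.IsBounded B ∧ E D B)
    {S : Set (Fin 2 → ℝ)} (hS : IsSemialgebraic ℚ S) (hfin : volume S ≠ ⊤) :
    ∃ K : Set (Fin 2 → ℝ), IsSemialgebraic ℚ K ∧ Bornology.IsBounded K ∧ E S K := by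
  set σ : Equiv.Perm (Fin 2) := Equiv.swap 0 (Fin.last 1) with hσ
  have hσσ : ∀ i, σ (σ i) = i := fun i => by rw [hσ, Equiv.swap_apply_self]
  -- step 1: swap
  have hS1 : IsSemialgebraic ℚ (Grounding.perm (m := 1) σ S) := Grounding.isSemialgebraic_perm σ hS
  have hS1v : volume (Grounding.perm (m := 1) σ S) = volume S :=
    Grounding.volume_perm σ (IsSemialgebraic.measurableSet_holds hS)
  have e1 : E S (Grounding.perm (m := 1) σ S) := assembly_swap E HE σ hσσ hS
  -- step 2: ground the (new) last coordinate
  have e2 : E (Grounding.perm (m := 1) σ S) (Grounding.groundLast (Grounding.perm (m := 1) σ S)) :=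
    hground _ hS1 (by rwa [hS1v])
  have hS2 : IsSemialgebraic ℚ (Grounding.groundLast (Grounding.perm (m := 1) σ S)) :=
    Grounding.isSemialgebraic_groundLast hS1
  -- step 3: swap back; this is `groundIter S 1`
  have e3 : E (Grounding.groundLast (Grounding.perm (m := 1) σ S)) (Grounding.groundIter S 1) := by
    have h := assembly_swap E HE σ hσσ hS2
    have : Grounding.groundIter S 1 = Grounding.perm (m := 1) σ
        (Grounding.groundLast (Grounding.perm (m := 1) σ S)) := by
      show (if h : 0 < 1 + 1 then Grounding.groundAt ⟨0, h⟩ (Grounding.groundIter S 0)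
        else Grounding.groundIter S 0) = _
      rw [dif_pos (by norm_num)]
      rfl
    rwa [this]
  obtain ⟨hG1sa, hG1v, -⟩ := Grounding.groundIter_spec (k := ℚ) hS 1
  -- step 4: ground the last coordinate; this is `groundIter S 2`
  have e4 : E (Grounding.groundIter S 1) (Grounding.groundIter S 2) := by
    have h := hground _ hG1sa (by rwa [hG1v])
    have : Grounding.groundIter S 2 = Grounding.groundLast (Grounding.groundIter S 1) := by
      show (if h : 1 < 1 + 1 then Grounding.groundAt ⟨1, h⟩ (Grounding.groundIter S 1)
        else Grounding.groundIter S 1) = _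
      rw [dif_pos (by norm_num)]
      exact assembly_groundAt_last (m := 1) _
    rwa [this]
  obtain ⟨hG2sa, hG2v, hG2⟩ := Grounding.groundIter_spec (k := ℚ) hS 2
  -- step 5: compress the down-set
  obtain ⟨K, hK, hKb, e5⟩ := hdownset (Grounding.groundIter S 2) hG2sa (by rwa [hG2v])
    (fun x hx i => (hG2 i i.isLt).1 x hx)
    (fun x hx y hy => Grounding.mem_of_forall_update_mem (fun i => (hG2 i i.isLt).2) hx hy)
  exact ⟨K, hK, hKb, htrans _ _ _ (htrans _ _ _ (htrans _ _ _ (htrans _ _ _ e1 e2) e3) e4) e5⟩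

/-- **Bounded models** (stub `stub_compress` of the line, the lead's reshaping of its assembly
stub): granted transitivity of `E`, the symplectic grounding of the last coordinate and the
compression of down-sets, every finite-area `ℚ`-region is `E`-equivalent to a bounded one
(`assembly_compress`). [folklore] -/
theorem stub_compress :
    ∀ (E : Set (Fin 2 → ℝ) → Set (Fin 2 → ℝ) → Prop),
      (∀ A B : Set (Fin 2 → ℝ), E A B ↔
        ∃ (U : Set (Fin 2 → ℝ)) (Φ : (Fin 2 → ℝ) → (Fin 2 → ℝ)),
          U ⊆ A ∧ IsSemialgebraic ℚ U ∧ IsOpen U ∧ volume (A \ U) = 0 ∧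
          IsSemialgebraicMapOn ℚ U Φ ∧ ContDiffOn ℝ 1 Φ U ∧ InjOn Φ U ∧
          (∀ p ∈ U, |(fderiv ℝ Φ p).det| = 1) ∧ Φ '' U ⊆ B ∧ volume (B \ Φ '' U) = 0) →
    (∀ A B C : Set (Fin 2 → ℝ), E A B → E B C → E A C) →
    (∀ S : Set (Fin 2 → ℝ), IsSemialgebraic ℚ S → volume S ≠ ⊤ →
      E S (Grounding.groundLast S)) →
    (∀ D : Set (Fin 2 → ℝ), IsSemialgebraic ℚ D → volume D ≠ ⊤ →
      (∀ x ∈ D, ∀ i, 0 < x i) →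
      (∀ x ∈ D, ∀ y : Fin 2 → ℝ, (∀ i, 0 < y i ∧ y i ≤ x i) → y ∈ D) →
      ∃ B : Set (Fin 2 → ℝ), IsSemialgebraic ℚ B ∧ Bornology.IsBounded B ∧ E D B) →
    ∀ S : Set (Fin 2 → ℝ), IsSemialgebraic ℚ S → volume S ≠ ⊤ →
      ∃ K : Set (Fin 2 → ℝ), IsSemialgebraic ℚ K ∧ Bornology.IsBounded K ∧ E S K := by
  intro E HE htrans hground hdownset S hS hfin
  exact assembly_compress E HE htrans hground hdownset hS hfin

end Summit.KontsevichZagierPeriods.SymplecticScissors.PlanarSAZylev
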